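import Literature.Probability.RandomPlanarGeometry.SAWRestrictionCovariance
import Literature.Probability.RandomPlanarGeometry.SAWEdgeListSurgery
import Literature.Probability.RandomPlanarGeometry.PolylineShellTraversals
import Literature.Probability.RandomPlanarGeometry.CurveTortuosity
import Literature.Probability.LatticeModels.MeshDomainJordan
import Literature.Probability.LatticeModels.LatticeDobrushinDomain
import HarnessLib

/-!
# Two-sided domain Markov property of the critical SAW weights, inequality form

Topic `Summits/CriticalPhenomena/SAWScalingLimit/Theorems` (stub V1b `stub_arcMarkov` of the line
`Sketch`, registration v6, for the crux `SAWRestrictionRigidity.EventualTight`; companion of the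
per-fibre cut/glue inequalities `ArcFibre`, stub V1a, which are taken here as a hypothesis).

The critical SAW measure `SAW.weight Ω δ a₀ b₀` gives the self-avoiding walk `γ` of the discrete
domain `Ω_δ` from `a₀` to `b₀` the mass `x_c^{|γ|}`.  Cut every walk at its FIRST and LAST vertex
failing a Boolean predicate `far` (with `far a₀ = far b₀ = true`): `support γ = β ++ α ++ β'`,
`β`, `β'` far throughout, `α` from `c` to `c'` with `far c = far c' = false`
(`SAW.exists_split_first_last`).  On a FIBRE (fixed `β`, `c`, `c'`, `β'`) the middle pieces are
the self-avoiding `Ω_δ`-arcs `c → c'` avoiding `β` and `β'`, with weight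
`x_c^{|β|+|β'|} · x_c^{|arc|}`; this is the hypothesis (`ArcFibre`, two weighted inequalities).
Consequently, if on every fibre met by an event `E` the arcs satisfying an event `A` carry at
most `θ ·` (the mass of all arcs of the fibre), and `E` forces `A` on the middle piece, then
`weight E ≤ θ · weight univ`: the two-sided domain Markov property of `P_δ ∝ x_c^{|γ|}`
(H. Duminil-Copin, S. Smirnov, Ann. of Math. 175 (2012), §2; N. Madras, G. Slade, *The
Self-Avoiding Walk* (1993), §3–§4) in the weighted-inequality form consumed by the virginization
of the bulk leaf.

Proof: both weights are sums over walks (`SAW.weight_apply_eq_tsum_indicator`); regroup them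
over the fibres of the frame map
`γ ↦ (takeWhile far, head of dropWhile far, the same two from the right end)`
(`Equiv.sigmaFiberEquiv`, `ENNReal.tsum_sigma'`); a fibre meeting `E` is the set of walks with a
decomposition `β ++ α ++ β'` with prescribed `β`, `β'` and end points of `α`
(`SAW.split_first_last_iff`), on which the two inequalities of the hypothesis and the bound on
`A`-arcs give the factor `θ`.  Everything here is [folklore] bookkeeping.
-/

noncomputable section

open MeasureTheory Filter Topology Set Metric
open scoped ENNReal NNReal unitInterval
open Literature.Probability.RandomPlanarGeometry Literature.Probability.LatticeModels

namespace Summit.CriticalPhenomena.SAWScalingLimit.Theorems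

/-- The frame `(takeWhile p, head of dropWhile p, head of dropWhile p from the right, final
takeWhile p block)` of a list is `(β, some c₁, some c₂, β')` (for `p c₁ = p c₂ = false` and `β`,
`β'` satisfying `p` throughout) iff the list decomposes as `β ++ α ++ β'` with `α` from `c₁` to
`c₂` (`SAW.split_first_last_iff`). [folklore] -/
private theorem arcMarkov_frame_eq_iff {V : Type*} (p : V → Bool) {L β β' : List V} {c₁ c₂ : V}
    (h₁ : p c₁ = false) (h₂ : p c₂ = false) (hβ : ∀ v ∈ β, p v = true)
    (hβ' : ∀ v ∈ β', p v = true) :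
    (L.takeWhile p, (L.dropWhile p).head?, (L.reverse.dropWhile p).head?,
        (L.reverse.takeWhile p).reverse) = (β, some c₁, some c₂, β') ↔
      ∃ α, L = β ++ α ++ β' ∧ α.head? = some c₁ ∧ α.getLast? = some c₂ := by
  rw [← SAW.split_first_last_iff p h₁ h₂ hβ hβ', Prod.mk.injEq, Prod.mk.injEq, Prod.mk.injEq]
  constructor
  · rintro ⟨e1, e2, e3, e4⟩
    exact ⟨⟨c₁, (List.dropWhile_suffix p).subset (List.mem_of_head? e2), h₁⟩, e1, e2, e3, e4⟩
  · rintro ⟨-, e1, e2, e3, e4⟩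
    exact ⟨e1, e2, e3, e4⟩

/-- Restricting a sum over a subtype to an event and enlarging the cut-out predicate.
[folklore] -/
private theorem arcMarkov_tsum_indicator_le {ι : Type*} {P Q : ι → Prop} (E : Set ι)
    (f : ι → ℝ≥0∞) (h : ∀ i, P i → i ∈ E → Q i) :
    ∑' i : {i // P i}, E.indicator f i.1 ≤ ∑' i : {i // Q i}, f i.1 := by
  classical
  calc ∑' i : {i // P i}, E.indicator f i.1 = ∑' i, {i | P i}.indicator (E.indicator f) i :=
        tsum_subtype {i | P i} (E.indicator f)
    _ ≤ ∑' i, {i | Q i}.indicator f i := by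
        refine ENNReal.tsum_le_tsum fun i => ?_
        rw [Set.indicator_indicator]
        exact Set.indicator_le_indicator_of_subset (fun j hj => h j hj.1 hj.2)
          (fun _ => zero_le) i
    _ = ∑' i : {i // Q i}, f i.1 := (tsum_subtype {i | Q i} f).symm

/-- Sums over the subtypes cut out by two equivalent predicates agree. [folklore] -/
private theorem arcMarkov_tsum_subtype_congr {ι : Type*} {P Q : ι → Prop} (f : ι → ℝ≥0∞)
    (h : ∀ i, P i ↔ Q i) :
    ∑' i : {i // P i}, f i.1 = ∑' i : {i // Q i}, f i.1 := by
  obtain rfl : P = Q := funext fun i => propext (h i)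
  rfl

/-- **Two-sided domain Markov property of the critical SAW weights, inequality form** (stub V1b
of the line `Sketch`, v6): from the per-fibre cut/glue inequalities (the hypothesis, `ArcFibre`),
if every walk of the event `E` has a vertex failing `far` (`far a₀ = far b₀ = true`), `E` forces
the event `A` on the middle piece `α` of the first/last-visit decomposition `β ++ α ++ β'` of the
support, and on every fibre met by `E` the `x_c`-mass of the self-avoiding arcs `c → c'` avoiding
`β`, `β'` with `A` is at most `θ ·` (the mass of all such arcs), then
`weight E ≤ θ · weight univ`. [cite: DuminilCopinSmirnov2012, §2] -/
theorem stub_arcMarkov :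
    (∀ (Ω : Set ℂ) (δ : ℝ) (a₀ b₀ : Site 2) (γ₀ : SAW.DomainSAW Ω δ a₀ b₀) (β α₀ β' : List (Site 2))
      (c c' : Site 2) (A : List (Site 2) → Prop),
      γ₀.walk.support = β ++ α₀ ++ β' → α₀.head? = some c → α₀.getLast? = some c' →
      (∑' γ : {γ : SAW.DomainSAW Ω δ a₀ b₀ // ∃ α : List (Site 2), γ.walk.support = β ++ α ++ β' ∧
            α.head? = some c ∧ α.getLast? = some c' ∧ A α},
          ENNReal.ofReal (SAW.criticalFugacity ^ γ.1.length) ≤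
        ENNReal.ofReal (SAW.criticalFugacity ^ (β.length + β'.length)) *
          ∑' p : {p : {p : (discreteDomainGraph Ω δ).Walk c c' //
              p.IsPath ∧ ∀ v ∈ p.support, v ∈ {v : Site 2 | v ∉ β ∧ v ∉ β'}} // A p.1.support},
            ENNReal.ofReal (SAW.criticalFugacity ^ p.1.1.length)) ∧
      (ENNReal.ofReal (SAW.criticalFugacity ^ (β.length + β'.length)) *
          ∑' p : {p : (discreteDomainGraph Ω δ).Walk c c' //
              p.IsPath ∧ ∀ v ∈ p.support, v ∈ {v : Site 2 | v ∉ β ∧ v ∉ β'}},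
            ENNReal.ofReal (SAW.criticalFugacity ^ p.1.length) ≤
        ∑' γ : {γ : SAW.DomainSAW Ω δ a₀ b₀ // ∃ α : List (Site 2), γ.walk.support = β ++ α ++ β' ∧
            α.head? = some c ∧ α.getLast? = some c'},
          ENNReal.ofReal (SAW.criticalFugacity ^ γ.1.length))) →
    ∀ (Ω : Set ℂ) (δ : ℝ) (a₀ b₀ : Site 2) (far : Site 2 → Bool) (E : Set (SAW.DomainSAW Ω δ a₀ b₀))
      (A : List (Site 2) → Prop) (θ : ℝ≥0∞),
      far a₀ = true → far b₀ = true →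
      (∀ γ ∈ E, ∃ v ∈ γ.walk.support, far v = false) →
      (∀ γ ∈ E, ∀ (β α β' : List (Site 2)) (c c' u u' : Site 2),
        γ.walk.support = β ++ α ++ β' → α.head? = some c → α.getLast? = some c' →
        β.getLast? = some u → β'.head? = some u' → far c = false → far c' = false →
        (∀ v ∈ β, far v = true) → (∀ v ∈ β', far v = true) → A α) →
      (∀ γ ∈ E, ∀ (β α β' : List (Site 2)) (c c' u u' : Site 2),
        γ.walk.support = β ++ α ++ β' → α.head? = some c → α.getLast? = some c' →
        β.getLast? = some u → β'.head? = some u' → far c = false → far c' = false →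
        (∀ v ∈ β, far v = true) → (∀ v ∈ β', far v = true) →
        ∑' p : {p : {p : (discreteDomainGraph Ω δ).Walk c c' //
            p.IsPath ∧ ∀ v ∈ p.support, v ∈ {v : Site 2 | v ∉ β ∧ v ∉ β'}} // A p.1.support},
            ENNReal.ofReal (SAW.criticalFugacity ^ p.1.1.length) ≤
          θ * ∑' p : {p : (discreteDomainGraph Ω δ).Walk c c' //
            p.IsPath ∧ ∀ v ∈ p.support, v ∈ {v : Site 2 | v ∉ β ∧ v ∉ β'}},
            ENNReal.ofReal (SAW.criticalFugacity ^ p.1.length)) →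
      SAW.weight Ω δ a₀ b₀ E ≤ θ * SAW.weight Ω δ a₀ b₀ Set.univ  := by
  intro hAF Ω δ a₀ b₀ far E A θ ha₀ hb₀ hE hEA hArc
  classical
  rw [SAW.weight_apply_eq_tsum_indicator, SAW.weight_apply_eq_tsum_indicator, Set.indicator_univ]
  set W : SAW.DomainSAW Ω δ a₀ b₀ → ℝ≥0∞ :=
    fun γ => ENNReal.ofReal (SAW.criticalFugacity ^ γ.length)
  -- the frame map; both sums regrouped over its fibres
  set fr : SAW.DomainSAW Ω δ a₀ b₀ →
      List (Site 2) × Option (Site 2) × Option (Site 2) × List (Site 2) :=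
    fun γ => (γ.walk.support.takeWhile far, (γ.walk.support.dropWhile far).head?,
      (γ.walk.support.reverse.dropWhile far).head?,
      (γ.walk.support.reverse.takeWhile far).reverse) with hfr
  rw [← (Equiv.sigmaFiberEquiv fr).tsum_eq (E.indicator W), ← (Equiv.sigmaFiberEquiv fr).tsum_eq W,
    ENNReal.tsum_sigma', ENNReal.tsum_sigma', ← ENNReal.tsum_mul_left]
  refine ENNReal.tsum_le_tsum fun k => ?_
  simp only [Equiv.sigmaFiberEquiv_apply]
  -- a fibre missing `E` contributes `0`
  by_cases hk : ∃ γ₀ : SAW.DomainSAW Ω δ a₀ b₀, fr γ₀ = k ∧ γ₀ ∈ E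
  swap
  · have h0 : ∀ γ : {γ // fr γ = k}, E.indicator W γ.1 = 0 := fun γ =>
      Set.indicator_of_notMem (fun hγE => hk ⟨γ.1, γ.2, hγE⟩) _
    rw [tsum_congr h0, tsum_zero]
    exact zero_le
  -- a fibre meeting `E` at `γ₀`: its frame is read off the first/last-visit decomposition of `γ₀`
  obtain ⟨γ₀, hγ₀k, hγ₀E⟩ := hk
  obtain ⟨β, α₀, β', c, c', hdec, hh, hl, hc, hc', hβ, hβ'⟩ :=
    SAW.exists_split_first_last far (hE γ₀ hγ₀E)
  obtain ⟨f1, f2, f3, f4⟩ := SAW.split_first_last_eq far hh hl hc hc' hβ hβ'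
  have hk' : k = (β, some c, some c', β') := by
    rw [← hγ₀k, hfr]
    simp only [hdec, f1, f2, f3, f4]
  subst hk'
  -- `β`, `β'` are nonempty (the walk starts at `a₀` and ends at `b₀`, both far): doors exist
  have hβne : β ≠ [] := by
    rintro rfl
    have h1 : γ₀.walk.support.head? = some a₀ := by
      rw [List.head?_eq_some_head γ₀.walk.support_ne_nil, γ₀.walk.head_support]
    rw [hdec, List.nil_append, List.head?_append, hh, Option.some_or, Option.some.injEq] at h1
    rw [h1, ha₀] at hc
    exact Bool.noConfusion hc
  have hβ'ne : β' ≠ [] := by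
    rintro rfl
    have h1 : γ₀.walk.support.getLast? = some b₀ := by
      rw [List.getLast?_eq_some_getLast γ₀.walk.support_ne_nil, γ₀.walk.getLast_support]
    rw [hdec, List.append_nil, List.getLast?_append, hl, Option.some_or, Option.some.injEq] at h1
    rw [h1, hb₀] at hc'
    exact Bool.noConfusion hc'
  obtain ⟨u, hu⟩ : ∃ u, β.getLast? = some u := ⟨_, List.getLast?_eq_some_getLast hβne⟩
  obtain ⟨u', hu'⟩ : ∃ u', β'.head? = some u' := ⟨_, List.head?_eq_some_head hβ'ne⟩
  -- the fibre is the set of walks decomposing as `β ++ α ++ β'` with `α` from `c` to `c'`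
  have hfib : ∀ γ : SAW.DomainSAW Ω δ a₀ b₀, fr γ = (β, some c, some c', β') ↔
      ∃ α, γ.walk.support = β ++ α ++ β' ∧ α.head? = some c ∧ α.getLast? = some c' :=
    fun γ => arcMarkov_frame_eq_iff far hc hc' hβ hβ'
  -- the per-fibre inequalities: cut, bound the `A`-arcs by `θ`, glue
  obtain ⟨hcut, hglue⟩ := hAF Ω δ a₀ b₀ γ₀ β α₀ β' c c' A hdec hh hl
  have hθ := hArc γ₀ hγ₀E β α₀ β' c c' u u' hdec hh hl hu hu' hc hc' hβ hβ'
  have key : ∑' γ : {γ : SAW.DomainSAW Ω δ a₀ b₀ // ∃ α : List (Site 2),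
        γ.walk.support = β ++ α ++ β' ∧ α.head? = some c ∧ α.getLast? = some c' ∧ A α}, W γ.1 ≤
      θ * ∑' γ : {γ : SAW.DomainSAW Ω δ a₀ b₀ // ∃ α : List (Site 2),
        γ.walk.support = β ++ α ++ β' ∧ α.head? = some c ∧ α.getLast? = some c'}, W γ.1 :=
    hcut.trans ((mul_le_mul_right hθ _).trans
      ((mul_left_comm _ _ _).trans_le (mul_le_mul_right hglue _)))
  calc ∑' γ : {γ // fr γ = (β, some c, some c', β')}, E.indicator W γ.1
      ≤ ∑' γ : {γ : SAW.DomainSAW Ω δ a₀ b₀ // ∃ α : List (Site 2),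
          γ.walk.support = β ++ α ++ β' ∧ α.head? = some c ∧ α.getLast? = some c' ∧ A α},
          W γ.1 := by
        refine arcMarkov_tsum_indicator_le E W fun γ hγ hγE => ?_
        obtain ⟨α, hsup, hh', hl'⟩ := (hfib γ).1 hγ
        exact ⟨α, hsup, hh', hl', hEA γ hγE β α β' c c' u u' hsup hh' hl' hu hu' hc hc' hβ hβ'⟩
    _ ≤ θ * ∑' γ : {γ : SAW.DomainSAW Ω δ a₀ b₀ // ∃ α : List (Site 2),
          γ.walk.support = β ++ α ++ β' ∧ α.head? = some c ∧ α.getLast? = some c'}, W γ.1 := key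
    _ = θ * ∑' γ : {γ // fr γ = (β, some c, some c', β')}, W γ.1 := by
        rw [arcMarkov_tsum_subtype_congr W hfib]

end Summit.CriticalPhenomena.SAWScalingLimit.Theorems

end
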